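import Summits.ABC.IUTFork.Cor312PilotIdelesM
import Summits.ABC.IUTFork.Cor312ThetaFinitePrVolMSharp
import Literature.IUT.LogVolume.TensorPacketSlotUnion
import HarnessLib

/-!
# [IUTchIII] Cor. 3.12 at the M-LEVEL genuine sharp setting of record (`settingPrVolSharpM`, summand route): LOCALITY of
# the local Θ-terms, `−|log(Θ)|(t_q, t) − −|log(Θ)|(𝟙)` supported on the bad rational places, and the exact criterion

PROOF-ONLY support piece of the abc-iut cell (Cor. 3.12 cone, D-0067; seat abc-iut-w4-d107, gen 5; part 16 of the
`Cor312NegLogThetaUpperPrVol*` / `Cor312RegimeVerbatimPrVol*` chain — the M-LEVEL TWIN of parts 11 and 14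
(`Cor312RegimeVerbatimPrVolExact`, `…ExactGeneral`, F/K-level `Real.settingPrVolSharp`)). TAKES NO SIDE on [IUTchIII]
Cor. 3.12; theorems only, 0 `def`s, no new `Prop` fact, no instance.

The C branch's line of record is the M-level summand-route setting (abc-iut-w5-d166 / w4-d013 / s2-p*:
`settingPrVolSharpM D hlog t tq …` over the genuine carriers `K_{v̲}`, `v̲ ∈ V̲`, of [IUTchI] Def. 3.1 (e), with the sharp
Dupuy–Hilado Θ-boxes `ι_j(t_{Θ,j,v̲_j})·(R_I)^∼` (`sharpBoxM`, `thetaBoxM`) and the `q`-centre `qCentreM` read off Θ- and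
`q`-ideles; downstream certificate `Conditional.abc_of_cor312Statement_genuineM`, p443000). THIS FILE ports the
F/K-level locality and decomposition to it:

* §1 LOCALITY — `sharpBoxM_eq_of_norm_eq_at` (per rational place: the sharp Θ-boxes over `u` read the Θ-ideles only
  through their norms over `u`; per-place form of abc-iut-w5-d166's `sharpBoxM_eq_of_norm_eq`, a slot unit does not move
  `(R_I)^∼`, abc-iut-S1 `iota_smul_normalizedPacket_eq_of_norm_eq_one`), `thetaLocal_settingPrVolM_congr_thetaBox` (the
  local Θ-term of abc-iut-w4-d013's `settingPrVolM` at `(j, v_ℚ)` reads the Θ-box binder only at `(j, v_ℚ)` and the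
  `q`-centre not at all), **`thetaLocal_settingPrVolSharpM_non_eq_of_norm_eq_at`** (`−|log(Θ)|_{j,u}` of
  `settingPrVolSharpM` is the same for two Θ-idele families with equal norms over `u`, whatever the Θ-ideles elsewhere and
  whatever the `q`-ideles and their unit sets `S_q`);
* §2 DECOMPOSITION — **`negLogTheta_settingPrVolSharpM_eq_trivial_add_sum_sub`**: for Θ-ideles `t` (non-zero, units off
  a finite set `S_Θ` of rational places) and any `q`-ideles (non-zero, units off `S_q`):
  `−|log(Θ)|(t_q, t) = −|log(Θ)|(𝟙) + PN_i Σ_{u∈S_Θ} (−|log(Θ)|_{i+1,u}(t_q, t) − −|log(Θ)|_{i+1,u}(𝟙))`, `𝟙` = the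
  trivial (unit) Θ- and `q`-ideles at the same context (`S_q := ∅`): the difference of the M-level Θ-volume and the
  trivial configuration's is SUPPORTED ON `S_Θ` (off `S_Θ` unit boxes on both sides, same local term by §1; at `∞` both
  vanish — trivial archimedean container); `negLogTheta_settingPrVolSharpM_trivial_ne_top`;
* §3 CRITERION — **`statement_settingPrVolSharpM_iff_general`**:
  `Statement(t_q, t) ⟺ ↑(−|log(q)|(t_q) − PN_i Σ_{u∈S_Θ} (−|log(Θ)|_{i+1,u}(t) − −|log(Θ)|_{i+1,u}(𝟙))) ≤ −|log(Θ)|(𝟙)`: at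
  the M-level genuine setting of a datum (s2-p8: `t, t_q :=` the datum's own ideles) the typed [IUTchIII] Cor. 3.12 is
  decided by the local Θ-terms AT THE BAD RATIONAL PLACES against ONE datum-independent number, the M-level Θ-volume of
  the trivial configuration (the hull inflation of the unit boxes at the ramified/dyadic packets of `K_{v̲}`).
HONEST SCOPE: bookkeeping about OUR typed objects at the M-level sharp setting ((Ind2) as typed, `Real.ismDH`-type
packet automorphisms; sharp (Ind3) reading, Dupuy–Hilado §4.10; trivial archimedean container; idele BINDERS);
nothing here asserts or denies [IUTchIII] Cor. 3.12 for initial Θ-data, and nothing is claimed about the SIZE of the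
local terms at the bad places or of `−|log(Θ)|(𝟙)` (abc-iut-c312-5's hull-gain files, s2-p8's orbit bound hA).
typed ≠ proved; instantiated ≠ endorsed. [claim: Mochizuki2012, status: disputed]
[cite: DupuyHilado2025, §3.6, §3.7, §3.9, §4.9, §4.10] [cite: Mochizuki2012, IUTchI Def. 3.1 (e) p. 62; IUTchIV Thm. 1.10 Step (v) p. 27]
-/

noncomputable section

open Set Function NumberField IsDedekindDomain
open scoped Pointwise

namespace Summit.ABC.IUTFork.Thm311.Real

open Cor312 Cor312.Setting Cor312Vol Literature.IUT.LogThetaLattice Literature.IUT.LogVolume Literature.IUT.HodgeTheaters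
  Literature.NumberTheory.NumberFields

variable {F K Fbar : Type} [Field F] [NumberField F] [Field K] [NumberField K] [Algebra F K]
  [Field Fbar] [Algebra F Fbar] [Algebra K Fbar] {E : WeierstrassCurve F} [E.IsElliptic] {l : ℕ}
  {Pb : BadPlacePredicates K} (D : InitialThetaData F K Fbar E l Pb) {logvK : PadicLogsVal K}
  (hlog : LogvAnalyticVal logvK)

/-! ## §1. Locality: the local Θ-term at `(j, u)` reads only the Θ-idele norms over `u` -/

section Locality

variable
  (t t' : ∀ (u : FinitePlace ℚ) (_ : Fin (thetaIndexOfInitial D).lstar) (x : (thetaIndexOfInitial D).Fibre (Val.non u)),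
    kOfM D (ratChar u) u (natCast_ratChar_mem u) x)

/-- At a fixed rational place `u`, the label idele has the same absolute value for two Θ-idele families with the same
absolute values OVER `u`. [cite: DupuyHilado2025, §3.9] -/
theorem norm_labelIdeleM_eq_of_norm_eq_at (u : FinitePlace ℚ) (h : ∀ i x, ‖t u i x‖ = ‖t' u i x‖)
    (j : (thetaIndexOfInitial D).Label) (x : (thetaIndexOfInitial D).Fibre (Val.non u)) :
    ‖labelIdeleM D t u j x‖ = ‖labelIdeleM D t' u j x‖ := by
  unfold labelIdeleM
  split_ifs
  · exact h _ _
  · rfl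

/-- **The sharp M-level Θ-boxes `ι_j(t_{Θ,j,v̲_j})·(R_I)^∼` over a rational place `u` depend on the Θ-ideles only through
their absolute values OVER `u`** (per-place form of abc-iut-w5-d166's `sharpBoxM_eq_of_norm_eq`: a slot unit does not move
`(R_I)^∼`, abc-iut-S1 `iota_smul_normalizedPacket_eq_of_norm_eq_one`). [cite: DupuyHilado2025, §3.7, §3.9]
[cite: Mochizuki2012, IUTchIV Thm. 1.10 Step (v) p. 27] -/
theorem sharpBoxM_eq_of_norm_eq_at (ht0 : ∀ u i x, t u i x ≠ 0) (u : FinitePlace ℚ)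
    (h : ∀ i x, ‖t u i x‖ = ‖t' u i x‖) (j : (thetaIndexOfInitial D).Label)
    (e : (thetaIndexOfInitial D).Caps j → (thetaIndexOfInitial D).Fibre (Val.non u)) :
    sharpBoxM D hlog t u j e = sharpBoxM D hlog t' u j e := by
  have ha : labelIdeleM D t u j (e (Fin.last _)) ≠ 0 := labelIdeleM_ne_zero D t ht0 u j _
  have hn := norm_labelIdeleM_eq_of_norm_eq_at D t t' u h j (e (Fin.last _))
  have hna : ‖labelIdeleM D t u j (e (Fin.last _))‖ ≠ 0 := norm_ne_zero_iff.mpr ha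
  have hu : ‖(labelIdeleM D t u j (e (Fin.last _)))⁻¹ * labelIdeleM D t' u j (e (Fin.last _))‖ = 1 := by
    rw [norm_mul, norm_inv, ← hn, inv_mul_cancel₀ hna]
  have hdec : labelIdeleM D t' u j (e (Fin.last _)) =
      labelIdeleM D t u j (e (Fin.last _)) *
        ((labelIdeleM D t u j (e (Fin.last _)))⁻¹ * labelIdeleM D t' u j (e (Fin.last _))) := by
    rw [mul_inv_cancel_left₀ ha]
  -- `ι(t') = ι(t)·ι(u)` with `u = t⁻¹·t'` a unit, and `ι(u)·(R_I)^∼ = (R_I)^∼`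
  have hmul : iota (ratChar u) ((presAtM D hlog u).kk e) (Fin.last _) (labelIdeleM D t' u j (e (Fin.last _))) =
      iota (ratChar u) ((presAtM D hlog u).kk e) (Fin.last _) (labelIdeleM D t u j (e (Fin.last _))) *
        iota (ratChar u) ((presAtM D hlog u).kk e) (Fin.last _)
          ((labelIdeleM D t u j (e (Fin.last _)))⁻¹ * labelIdeleM D t' u j (e (Fin.last _))) := by
    conv_lhs => rw [hdec]
    exact map_mul _ _ _
  have key : iota (ratChar u) ((presAtM D hlog u).kk e) (Fin.last _) (labelIdeleM D t' u j (e (Fin.last _))) •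
        (normalizedPacket (ratChar u) ((presAtM D hlog u).kk e) :
          Set (PacketAlgebra (ratChar u) ((presAtM D hlog u).kk e))) =
      iota (ratChar u) ((presAtM D hlog u).kk e) (Fin.last _) (labelIdeleM D t u j (e (Fin.last _))) •
        (normalizedPacket (ratChar u) ((presAtM D hlog u).kk e) :
          Set (PacketAlgebra (ratChar u) ((presAtM D hlog u).kk e))) := by
    rw [hmul, ← smul_smul,
      iota_smul_normalizedPacket_eq_of_norm_eq_one (ratChar u) ((presAtM D hlog u).kk e) (Fin.last _) hu]
  exact key.symm

variable (M : Type) [Field M] [NumberField M]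
  (archPk : ∀ (j : (thetaIndexOfInitial D).Label) (vQ : (thetaIndexOfInitial D).VQ),
    Set ((logShellsOfInitialDH D logvK).Packet j vQ))
  (archSub : ∀ (j : (thetaIndexOfInitial D).Label) (v : (thetaIndexOfInitial D).V),
    Set ((logShellsOfInitialDH D logvK).Packet j ((thetaIndexOfInitial D).over v)))
  (Ψ : ℤ → ∀ v : (thetaIndexOfInitial D).V, v ∈ (thetaIndexOfInitial D).Vbad →
    Set ((logShellsOfInitialDH D logvK).StarPacket v))
  (act : ℤ → ∀ v : (thetaIndexOfInitial D).V, v ∈ (thetaIndexOfInitial D).Vbad →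
    (logShellsOfInitialDH D logvK).StarPacket v → Module.End ℚ ((logShellsOfInitialDH D logvK).StarPacket v))
  (Mmod : ℤ → ∀ j : (thetaIndexOfInitial D).LabelStar, Set ((logShellsOfInitialDH D logvK).GlobalPacket j.1))
  (region : ℤ → ∀ j : (thetaIndexOfInitial D).LabelStar, FinDivisor M → ∀ vQ : (thetaIndexOfInitial D).VQ,
    Set ((logShellsOfInitialDH D logvK).Packet j.1 vQ))
  (n : ℤ) {HT : Type} {LogLink : HT → HT → Type} {IsFull : ∀ {s t : HT}, LogLink s t → Prop}
  (lat : LGPGaussianLogThetaLattice LogLink IsFull)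
  {Frd : Type} {IsoF : Frd → Frd → Type} {Ob : Frd → Type} {realify : Frd → Frd} {Strip : Type}
  {IsoS : Strip → Strip → Type} {Mv : ∀ v : (thetaIndexOfInitial D).V, v ∈ (thetaIndexOfInitial D).Vbad → Type}
  [∀ v h, Monoid (Mv v h)]
  (sig : GlobalLGPFrobenioidSignature (thetaIndexOfInitial D).lstar (thetaIndexOfInitial D).V
    (· ∈ (thetaIndexOfInitial D).Vbad) Frd IsoF Ob realify Strip IsoS Mv)
  (split : SplittingMonoids Mv) {ObΔ : Type} {N : ∀ v : (thetaIndexOfInitial D).V, v ∈ (thetaIndexOfInitial D).Vbad → Type}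
  [∀ v h, Monoid (N v h)] (qData : QPilotData ObΔ N)

/-- **The local Θ-term of abc-iut-w4-d013's assembled M-level setting at `(j, v_ℚ)` reads the Θ-box binder only at
`(j, v_ℚ)`** (and the `q`-centre binder not at all): the hull frame, the (Ind1)/(Ind2)-orbit of the (Ind3)-region, the
holomorphic hull and its log-volume at `(j, v_ℚ)` are assembled from the Θ-boxes at `(j, v_ℚ)` alone
(`Setting.ofComparison`; M-twin of part 11's `thetaLocal_settingPrVol_congr_thetaBox`). [folklore] -/
theorem thetaLocal_settingPrVolM_congr_thetaBox
    {thetaBox thetaBox' : ℤ → Ob sig.Clgp → ∀ (j : (thetaIndexOfInitial D).Label) (vQ : (thetaIndexOfInitial D).VQ),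
      Set (∀ s : factorIdxM D hlog j vQ, factorFieldM D hlog j vQ s)}
    {qCentre qCentre' : ObΔ → ∀ (j : (thetaIndexOfInitial D).Label) (vQ : (thetaIndexOfInitial D).VQ),
      ∀ s : factorIdxM D hlog j vQ, factorFieldM D hlog j vQ s}
    {hq : ∀ j vQ s, qCentre (qPilotObject qData) j vQ s ≠ 0} {hq' : ∀ j vQ s, qCentre' (qPilotObject qData) j vQ s ≠ 0}
    {hfin : ∀ j : (thetaIndexOfInitial D).Label, (Function.support fun vQ =>
      ((situationPrVolM D hlog M archPk archSub Ψ act Mmod region).D n).logvol j vQ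
        (factorMapM D hlog j vQ ⁻¹' hullSet (factorFieldM D hlog j vQ) (qCentre (qPilotObject qData) j vQ))).Finite}
    {hfin' : ∀ j : (thetaIndexOfInitial D).Label, (Function.support fun vQ =>
      ((situationPrVolM D hlog M archPk archSub Ψ act Mmod region).D n).logvol j vQ
        (factorMapM D hlog j vQ ⁻¹' hullSet (factorFieldM D hlog j vQ) (qCentre' (qPilotObject qData) j vQ))).Finite}
    (j : (thetaIndexOfInitial D).Label) (vQ : (thetaIndexOfInitial D).VQ)
    (h : ∀ (m : ℤ) (o : Ob sig.Clgp), thetaBox m o j vQ = thetaBox' m o j vQ) :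
    (settingPrVolM D hlog M archPk archSub Ψ act Mmod region n lat sig split qData thetaBox qCentre hq hfin).thetaLocal
        j vQ =
      (settingPrVolM D hlog M archPk archSub Ψ act Mmod region n lat sig split qData thetaBox' qCentre' hq'
        hfin').thetaLocal j vQ := by
  have h3 : (settingPrVolM D hlog M archPk archSub Ψ act Mmod region n lat sig split qData thetaBox qCentre hq
        hfin).thetaRegion3 j vQ =
      (settingPrVolM D hlog M archPk archSub Ψ act Mmod region n lat sig split qData thetaBox' qCentre' hq'
        hfin').thetaRegion3 j vQ := by
    unfold Setting.thetaRegion3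
    refine Set.iUnion_congr fun m => ?_
    show factorMapM D hlog j vQ ⁻¹' thetaBox m (thetaPilotObject sig split) j vQ =
      factorMapM D hlog j vQ ⁻¹' thetaBox' m (thetaPilotObject sig split) j vQ
    rw [h]
  have hPI : (settingPrVolM D hlog M archPk archSub Ψ act Mmod region n lat sig split qData thetaBox qCentre hq
        hfin).possibleImages j vQ =
      (settingPrVolM D hlog M archPk archSub Ψ act Mmod region n lat sig split qData thetaBox' qCentre' hq'
        hfin').possibleImages j vQ := by
    unfold Setting.possibleImages
    rw [h3]
  unfold Setting.thetaLocal Setting.HullDefined Setting.thetaHull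
  rw [hPI]
  rfl

variable (tq tq' : ∀ (u : FinitePlace ℚ) (x : (thetaIndexOfInitial D).Fibre (Val.non u)),
    kOfM D (ratChar u) u (natCast_ratChar_mem u) x)

/-- **LOCALITY of the local Θ-term of the M-level sharp setting of record.** `−|log(Θ)|_{j,u}` of `settingPrVolSharpM` at
the packet `(j, u)` is the SAME for two Θ-idele families with the same absolute values OVER `u` — whatever the Θ-ideles
elsewhere and whatever the `q`-ideles (and their unit sets `S_q`): the Θ-box at `(j, u)` is `Π_{v⃗} ι_j(t_{Θ,j,v⃗(last)})·(R_{v⃗})^∼`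
(Dupuy–Hilado §3.9), a unit of the last tensor factor does not move `(R_{v⃗})^∼`, and the hull frame, the
(Ind1)/(Ind2)-orbit and the container volume at `(j, u)` read nothing else (M-twin of part 11's
`thetaLocal_settingPrVolSharp_inr_eq_of_norm_eq_at`). [cite: DupuyHilado2025, §3.7, §3.9, §4.9]
[cite: Mochizuki2012, IUTchIV Thm. 1.10 Step (v) p. 27] -/
theorem thetaLocal_settingPrVolSharpM_non_eq_of_norm_eq_at (ht0 : ∀ u i x, t u i x ≠ 0)
    (htq0 : ∀ u x, tq u x ≠ 0) (Sq : Finset (FinitePlace ℚ))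
    (htq1 : ∀ (u : FinitePlace ℚ) (x : (thetaIndexOfInitial D).Fibre (Val.non u)), u ∉ Sq → ‖tq u x‖ = 1)
    (htq0' : ∀ u x, tq' u x ≠ 0) (Sq' : Finset (FinitePlace ℚ))
    (htq1' : ∀ (u : FinitePlace ℚ) (x : (thetaIndexOfInitial D).Fibre (Val.non u)), u ∉ Sq' → ‖tq' u x‖ = 1)
    (u : FinitePlace ℚ) (h : ∀ i x, ‖t u i x‖ = ‖t' u i x‖) (j : (thetaIndexOfInitial D).Label) :
    (settingPrVolSharpM D hlog t tq M archPk archSub Ψ act Mmod region n lat sig split qData htq0 Sq htq1).thetaLocal j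
        (Val.non u) =
      (settingPrVolSharpM D hlog t' tq' M archPk archSub Ψ act Mmod region n lat sig split qData htq0' Sq'
        htq1').thetaLocal j (Val.non u) := by
  have hbox : sharpBoxM D hlog t u j = sharpBoxM D hlog t' u j :=
    funext fun e => sharpBoxM_eq_of_norm_eq_at D hlog t t' ht0 u h j e
  unfold settingPrVolSharpM
  refine thetaLocal_settingPrVolM_congr_thetaBox D hlog M archPk archSub Ψ act Mmod region n lat sig split qData j
    (Val.non u) fun m o => ?_
  show (presAtM D hlog u).boxOf (sharpBoxM D hlog t u j) = (presAtM D hlog u).boxOf (sharpBoxM D hlog t' u j)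
  rw [hbox]

end Locality

/-! ## §2. The decomposition: `−|log(Θ)|(t_q, t) − −|log(Θ)|(𝟙)` is supported on `S_Θ` -/

section Decomposition

variable (M : Type) [Field M] [NumberField M]
  (archPk : ∀ (j : (thetaIndexOfInitial D).Label) (vQ : (thetaIndexOfInitial D).VQ),
    Set ((logShellsOfInitialDH D logvK).Packet j vQ))
  (archSub : ∀ (j : (thetaIndexOfInitial D).Label) (v : (thetaIndexOfInitial D).V),
    Set ((logShellsOfInitialDH D logvK).Packet j ((thetaIndexOfInitial D).over v)))
  (Ψ : ℤ → ∀ v : (thetaIndexOfInitial D).V, v ∈ (thetaIndexOfInitial D).Vbad →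
    Set ((logShellsOfInitialDH D logvK).StarPacket v))
  (act : ℤ → ∀ v : (thetaIndexOfInitial D).V, v ∈ (thetaIndexOfInitial D).Vbad →
    (logShellsOfInitialDH D logvK).StarPacket v → Module.End ℚ ((logShellsOfInitialDH D logvK).StarPacket v))
  (Mmod : ℤ → ∀ j : (thetaIndexOfInitial D).LabelStar, Set ((logShellsOfInitialDH D logvK).GlobalPacket j.1))
  (region : ℤ → ∀ j : (thetaIndexOfInitial D).LabelStar, FinDivisor M → ∀ vQ : (thetaIndexOfInitial D).VQ,
    Set ((logShellsOfInitialDH D logvK).Packet j.1 vQ))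
  (n : ℤ) {HT : Type} {LogLink : HT → HT → Type} {IsFull : ∀ {s t : HT}, LogLink s t → Prop}
  (lat : LGPGaussianLogThetaLattice LogLink IsFull)
  {Frd : Type} {IsoF : Frd → Frd → Type} {Ob : Frd → Type} {realify : Frd → Frd} {Strip : Type}
  {IsoS : Strip → Strip → Type} {Mv : ∀ v : (thetaIndexOfInitial D).V, v ∈ (thetaIndexOfInitial D).Vbad → Type}
  [∀ v h, Monoid (Mv v h)]
  (sig : GlobalLGPFrobenioidSignature (thetaIndexOfInitial D).lstar (thetaIndexOfInitial D).V
    (· ∈ (thetaIndexOfInitial D).Vbad) Frd IsoF Ob realify Strip IsoS Mv)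
  (split : SplittingMonoids Mv) {ObΔ : Type} {N : ∀ v : (thetaIndexOfInitial D).V, v ∈ (thetaIndexOfInitial D).Vbad → Type}
  [∀ v h, Monoid (N v h)] (qData : QPilotData ObΔ N)
  (t : ∀ (u : FinitePlace ℚ) (_ : Fin (thetaIndexOfInitial D).lstar) (x : (thetaIndexOfInitial D).Fibre (Val.non u)),
    kOfM D (ratChar u) u (natCast_ratChar_mem u) x)
  (tq : ∀ (u : FinitePlace ℚ) (x : (thetaIndexOfInitial D).Fibre (Val.non u)),
    kOfM D (ratChar u) u (natCast_ratChar_mem u) x)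

/-- `ThetaFinite` of the M-level sharp setting of record (abc-iut-w5-d166's `thetaFinite_settingPrVolM_sharp`, read on
`settingPrVolSharpM` — the same term). [claim: Mochizuki2012, status: disputed] -/
theorem thetaFinite_settingPrVolSharpM_of_ideles (ht0 : ∀ u i x, t u i x ≠ 0) (Sθ : Finset (FinitePlace ℚ))
    (ht1 : ∀ (u : FinitePlace ℚ) (i : Fin (thetaIndexOfInitial D).lstar) (x : (thetaIndexOfInitial D).Fibre (Val.non u)),
      u ∉ Sθ → ‖t u i x‖ = 1)
    (htq0 : ∀ u x, tq u x ≠ 0) (Sq : Finset (FinitePlace ℚ))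
    (htq1 : ∀ (u : FinitePlace ℚ) (x : (thetaIndexOfInitial D).Fibre (Val.non u)), u ∉ Sq → ‖tq u x‖ = 1) :
    (settingPrVolSharpM D hlog t tq M archPk archSub Ψ act Mmod region n lat sig split qData htq0 Sq htq1).ThetaFinite :=
  thetaFinite_settingPrVolM_sharp D hlog M archPk archSub Ψ act Mmod region n lat sig split qData t tq htq0 _ ht0 Sθ ht1

/-- **`−|log(Θ)|(𝟙)` at the M-level is a real number** (the trivial configuration — unit Θ- and `q`-ideles, `S_q = ∅` — has
`ThetaFinite`). [claim: Mochizuki2012, status: disputed] -/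
theorem negLogTheta_settingPrVolSharpM_trivial_ne_top :
    (settingPrVolSharpM D hlog (fun _ _ _ => 1) (fun _ _ => 1) M archPk archSub Ψ act Mmod region n lat sig split qData
        (fun _ _ => one_ne_zero) ∅ (fun _ _ _ => norm_one)).negLogTheta ≠ ⊤ := by
  have hfinΘ₁ := thetaFinite_settingPrVolSharpM_of_ideles D hlog M archPk archSub Ψ act Mmod region n lat sig split qData
    (fun _ _ _ => 1) (fun _ _ => 1) (fun _ _ _ => one_ne_zero) ∅ (fun _ _ _ _ => norm_one) (fun _ _ => one_ne_zero) ∅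
    (fun _ _ _ => norm_one)
  unfold Setting.negLogTheta
  rw [if_pos hfinΘ₁]
  exact WithTop.coe_ne_top

/-- **THE M-LEVEL DECOMPOSITION: `−|log(Θ)|(t_q, t) − −|log(Θ)|(𝟙)` is supported on `S_Θ`.** For Θ-ideles `t` (non-zero,
units off a finite set `S_Θ` of rational places) and `q`-ideles `t_q` (non-zero, units off `S_q`):
`−|log(Θ)|(t_q, t) = −|log(Θ)|(𝟙) + PN_i Σ_{u∈S_Θ} (−|log(Θ)|_{i+1,u}(t_q, t) − −|log(Θ)|_{i+1,u}(𝟙))` at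
`settingPrVolSharpM`, where `𝟙` denotes the unit ideles at the same context (`S_q := ∅`): off `S_Θ` the Θ-boxes of `t`
are unit boxes and the local terms COINCIDE (§1 locality), at `∞` both vanish. M-twin of part 14's
`negLogTheta_settingPrVolSharp_eq_trivial_add_sum_sub`. [cite: DupuyHilado2025, §3.6, §3.9, §4.9]
[claim: Mochizuki2012, status: disputed] -/
theorem negLogTheta_settingPrVolSharpM_eq_trivial_add_sum_sub (ht0 : ∀ u i x, t u i x ≠ 0)
    (Sθ : Finset (FinitePlace ℚ))
    (ht1 : ∀ (u : FinitePlace ℚ) (i : Fin (thetaIndexOfInitial D).lstar) (x : (thetaIndexOfInitial D).Fibre (Val.non u)),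
      u ∉ Sθ → ‖t u i x‖ = 1)
    (htq0 : ∀ u x, tq u x ≠ 0) (Sq : Finset (FinitePlace ℚ))
    (htq1 : ∀ (u : FinitePlace ℚ) (x : (thetaIndexOfInitial D).Fibre (Val.non u)), u ∉ Sq → ‖tq u x‖ = 1) :
    (settingPrVolSharpM D hlog t tq M archPk archSub Ψ act Mmod region n lat sig split qData htq0 Sq htq1).negLogTheta =
      (settingPrVolSharpM D hlog (fun _ _ _ => 1) (fun _ _ => 1) M archPk archSub Ψ act Mmod region n lat sig split qData
          (fun _ _ => one_ne_zero) ∅ (fun _ _ _ => norm_one)).negLogTheta +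
        ((processionNormalized (fun i : Fin (thetaIndexOfInitial D).lstar => ∑ u ∈ Sθ,
          (((settingPrVolSharpM D hlog t tq M archPk archSub Ψ act Mmod region n lat sig split qData htq0 Sq
              htq1).thetaLocal (Setting.labelSucc i) (Val.non u)).untopD 0 -
            ((settingPrVolSharpM D hlog (fun _ _ _ => 1) (fun _ _ => 1) M archPk archSub Ψ act Mmod region n lat sig
              split qData (fun _ _ => one_ne_zero) ∅ (fun _ _ _ => norm_one)).thetaLocal (Setting.labelSucc i)
                (Val.non u)).untopD 0)) : ℝ) : WithTop ℝ) := by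
  classical
  have hfinΘ := thetaFinite_settingPrVolSharpM_of_ideles D hlog M archPk archSub Ψ act Mmod region n lat sig split qData
    t tq ht0 Sθ ht1 htq0 Sq htq1
  have hfinΘ₁ := thetaFinite_settingPrVolSharpM_of_ideles D hlog M archPk archSub Ψ act Mmod region n lat sig split qData
    (fun _ _ _ => 1) (fun _ _ => 1) (fun _ _ _ => one_ne_zero) ∅ (fun _ _ _ _ => norm_one) (fun _ _ => one_ne_zero) ∅
    (fun _ _ _ => norm_one)
  unfold Setting.negLogTheta
  rw [if_pos hfinΘ, if_pos hfinΘ₁, ← WithTop.coe_add, WithTop.coe_inj]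
  have hadd : ∀ f g : Fin (thetaIndexOfInitial D).lstar → ℝ,
      processionNormalized f + processionNormalized g = processionNormalized (fun i => f i + g i) := fun f g => by
    unfold processionNormalized; rw [Finset.sum_add_distrib, add_div]
  rw [hadd]
  refine congrArg processionNormalized (funext fun i => ?_)
  -- abbreviations for the two local-term functions at the label `i+1`
  set ft : (thetaIndexOfInitial D).VQ → ℝ := fun vQ =>
    ((settingPrVolSharpM D hlog t tq M archPk archSub Ψ act Mmod region n lat sig split qData htq0 Sq htq1).thetaLocal
      (Setting.labelSucc i) vQ).untopD 0 with hft
  set f1 : (thetaIndexOfInitial D).VQ → ℝ := fun vQ =>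
    ((settingPrVolSharpM D hlog (fun _ _ _ => 1) (fun _ _ => 1) M archPk archSub Ψ act Mmod region n lat sig split qData
      (fun _ _ => one_ne_zero) ∅ (fun _ _ _ => norm_one)).thetaLocal (Setting.labelSucc i) vQ).untopD 0 with hf1
  -- the correction: the difference on `S_Θ`, `0` elsewhere
  let g : (thetaIndexOfInitial D).VQ → ℝ := fun vQ =>
    match vQ with
    | .inl _ => 0
    | .inr u => if u ∈ Sθ then ft (Val.non u) - f1 (Val.non u) else 0
  have hg_supp : (Function.support g) ⊆
      ((Sθ.map ⟨(Val.non : FinitePlace ℚ → (thetaIndexOfInitial D).VQ), fun _ _ h => Sum.inr_injective h⟩ :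
        Finset (thetaIndexOfInitial D).VQ) : Set (thetaIndexOfInitial D).VQ) := by
    intro vQ hvQ
    rw [Function.mem_support] at hvQ
    rcases vQ with w | u
    · exact absurd rfl hvQ
    · rw [Finset.coe_map, Set.mem_image]
      by_cases hu : u ∈ Sθ
      · exact ⟨u, Finset.mem_coe.mpr hu, rfl⟩
      · exact absurd (by show g (.inr u) = 0; exact if_neg hu) hvQ
  have hg_fin : (Function.support g).Finite := (Finset.finite_toSet _).subset hg_supp
  have hsum : ∑ᶠ vQ, g vQ = ∑ u ∈ Sθ, (ft (Val.non u) - f1 (Val.non u)) := by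
    rw [finsum_eq_sum_of_support_subset g hg_supp, Finset.sum_map]
    exact Finset.sum_congr rfl fun u hu => if_pos hu
  show ∑ᶠ vQ, ft vQ = ∑ᶠ vQ, f1 vQ + ∑ u ∈ Sθ, (ft (Val.non u) - f1 (Val.non u))
  rw [← hsum, ← finsum_add_distrib (hfinΘ₁.2 i) hg_fin]
  refine finsum_congr fun vQ => ?_
  rcases vQ with w | u
  · -- at `∞`: both local terms vanish (trivial archimedean container)
    show ft (Val.arc w) = f1 (Val.arc w) + (0 : ℝ)
    rw [add_zero, hft, hf1]
    exact (congrArg (WithTop.untopD 0) (thetaLocal_settingPrVolM_arc D hlog M archPk archSub Ψ act Mmod region n lat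
      sig split qData _ _ _ _ (Setting.labelSucc i) w)).trans
      (congrArg (WithTop.untopD 0) (thetaLocal_settingPrVolM_arc D hlog M archPk archSub Ψ act Mmod region n lat sig
        split qData _ _ _ _ (Setting.labelSucc i) w)).symm
  · by_cases hu : u ∈ Sθ
    · -- on `S_Θ`: tautological
      show ft (Val.non u) = f1 (Val.non u) + g (.inr u)
      rw [show g (.inr u) = ft (Val.non u) - f1 (Val.non u) from if_pos hu]
      ring
    · -- off `S_Θ`: unit boxes on both sides, the same local term (§1)
      show ft (Val.non u) = f1 (Val.non u) + g (.inr u)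
      rw [show g (.inr u) = 0 from if_neg hu, add_zero, hft, hf1]
      exact congrArg (WithTop.untopD 0) (thetaLocal_settingPrVolSharpM_non_eq_of_norm_eq_at D hlog t (fun _ _ _ => 1)
        M archPk archSub Ψ act Mmod region n lat sig split qData tq (fun _ _ => 1) ht0 htq0 Sq htq1
        (fun _ _ => one_ne_zero) ∅ (fun _ _ _ => norm_one) u (fun i' x => by rw [ht1 u i' x hu, norm_one])
        (Setting.labelSucc i))

/-! ## §3. The general criterion at the M-level -/

/-- **THE M-LEVEL CRITERION.** For Θ-ideles (non-zero, units off `S_Θ`) and `q`-ideles (non-zero, units off `S_q`):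
`Statement(t_q, t) ⟺ ↑(−|log(q)|(t_q) − PN_i Σ_{u∈S_Θ} (−|log(Θ)|_{i+1,u}(t_q, t) − −|log(Θ)|_{i+1,u}(𝟙))) ≤ −|log(Θ)|(𝟙)` at
`settingPrVolSharpM` — at the M-level genuine setting of a datum (its own ideles) the typed [IUTchIII] Cor. 3.12 is
decided by the local Θ-terms AT THE BAD RATIONAL PLACES against the single number `−|log(Θ)|(𝟙)`; no side taken, and
nothing claimed about the sizes. M-twin of part 14's `statement_settingPrVolSharp_iff_general`.
[claim: Mochizuki2012, status: disputed] [cite: DupuyHilado2025, §3.6, §3.9, §4.9] -/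
theorem statement_settingPrVolSharpM_iff_general (ht0 : ∀ u i x, t u i x ≠ 0) (Sθ : Finset (FinitePlace ℚ))
    (ht1 : ∀ (u : FinitePlace ℚ) (i : Fin (thetaIndexOfInitial D).lstar) (x : (thetaIndexOfInitial D).Fibre (Val.non u)),
      u ∉ Sθ → ‖t u i x‖ = 1)
    (htq0 : ∀ u x, tq u x ≠ 0) (Sq : Finset (FinitePlace ℚ))
    (htq1 : ∀ (u : FinitePlace ℚ) (x : (thetaIndexOfInitial D).Fibre (Val.non u)), u ∉ Sq → ‖tq u x‖ = 1) :
    (settingPrVolSharpM D hlog t tq M archPk archSub Ψ act Mmod region n lat sig split qData htq0 Sq htq1).Statement ↔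
      (((settingPrVolSharpM D hlog t tq M archPk archSub Ψ act Mmod region n lat sig split qData htq0 Sq htq1).negLogQ -
          processionNormalized (fun i : Fin (thetaIndexOfInitial D).lstar => ∑ u ∈ Sθ,
            (((settingPrVolSharpM D hlog t tq M archPk archSub Ψ act Mmod region n lat sig split qData htq0 Sq
                htq1).thetaLocal (Setting.labelSucc i) (Val.non u)).untopD 0 -
              ((settingPrVolSharpM D hlog (fun _ _ _ => 1) (fun _ _ => 1) M archPk archSub Ψ act Mmod region n lat sig
                split qData (fun _ _ => one_ne_zero) ∅ (fun _ _ _ => norm_one)).thetaLocal (Setting.labelSucc i)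
                  (Val.non u)).untopD 0)) : ℝ) : WithTop ℝ) ≤
        (settingPrVolSharpM D hlog (fun _ _ _ => 1) (fun _ _ => 1) M archPk archSub Ψ act Mmod region n lat sig split
          qData (fun _ _ => one_ne_zero) ∅ (fun _ _ _ => norm_one)).negLogTheta := by
  have hdec := negLogTheta_settingPrVolSharpM_eq_trivial_add_sum_sub D hlog M archPk archSub Ψ act Mmod region n lat sig
    split qData t tq ht0 Sθ ht1 htq0 Sq htq1
  obtain ⟨K₀, hK₀⟩ := WithTop.ne_top_iff_exists.mp (negLogTheta_settingPrVolSharpM_trivial_ne_top D hlog M archPk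
    archSub Ψ act Mmod region n lat sig split qData)
  unfold Setting.Statement
  rw [hdec, ← hK₀, ← WithTop.coe_add, WithTop.coe_le_coe, WithTop.coe_le_coe]
  constructor
  · rintro ⟨-, h⟩
    linarith
  · intro h
    exact ⟨WithTop.coe_ne_top, by linarith⟩

end Decomposition

end Summit.ABC.IUTFork.Thm311.Real

end

-- tree-health (abc-iut-w6-d081 g4, 2026-08-26T14:59Z): comment-only re-land of a STRANDED ACCEPT (accepted 13:18Z, farm «stale:284:unbuilt» at 14:57Z);
-- declarations byte-identical; purpose = trigger the rebuild (re-land outside a reload window is served in 10–20 min, 12/12 today).
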